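import Literature.Computability.Complexity.IWBootstrapping
import Literature.Computability.Complexity.ArthurMerlinKarpClosure
import HarnessLib

/-!
# IW98 Lemma 16 with the strong construction available only from some length on

Literature / complexity — derandomization under a uniform assumption; corollary file of
`IWBootstrapping.lean` (`IWUniform.mem_BPP_of_dsr_of_stronglyConstructible`: Impagliazzo–Wigderson
1998, Lemma 16). In the printed proof the strong construction of `C^f` comes (Lemmas 13–15) from the
failure of the simulation "for all but finitely many" input lengths (Lemma 13: "fails with
probability `1/n^c` for all but finitely many `n`"; the tree's weak constructions
`IWUniform.WeaklyConstructible` are likewise "for all sufficiently large `n`"), so it is only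
guaranteed for `n ≥ n₀`. The finitely many small lengths are immaterial: hard-wire `f` below `n₀`
into the evaluator. This file proves that patch:

* the finite table: the tree's one-bit membership test `Brick.memListFn` (`ArthurMerlinKarpClosure.lean`)
  on the list `trueBelow f n₀` of the strings shorter than `n₀` where `f` is true;
* `IWUniform.Bootstrap.patchEv Ev f n₀` — the evaluator answering `[f y]` itself on `|y| < n₀`
  (table of the finitely many values) and `Ev ⟨d, y⟩` otherwise; `patchEv_mem_FP`,
  `circuitsFor_patchEv_of_lt` (below `n₀` EVERY description computes `f`),
  `circuitsFor_patchEv_of_le` (from `n₀` on nothing changes);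
* **`IWUniform.mem_BPP_of_dsr_of_eventually_stronglyConstructible`** — Lemma 16 from a strong
  construction valid for `n ≥ n₀` only: clock the construction (`OracleAlg.clock`, so that it always
  answers) and read its outputs through `patchEv`; then `C^f` relative to `patchEv` is strongly
  constructible at EVERY length and `IWUniform.mem_BPP_of_dsr_of_stronglyConstructible` applies.

Everything is proved; no named facts.

## References

* [ImpagliazzoWigderson2001] R. Impagliazzo, A. Wigderson, JCSS 63 (2001) 672–688, Lemma 13
  ("for all but finitely many `n`"), Lemma 16 (held text p. 7).
* [AroraBarakCC2009] S. Arora, B. Barak, CUP 2009, §1.4.1 (clocked simulation), §3.4.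
-/

noncomputable section

namespace Literature.Computability.Complexity

open _root_.Computability Polynomial Brick

namespace IWUniform

namespace Bootstrap

/-! ### A finite table in `FP` (the membership test `Brick.memListFn` of `ArthurMerlinKarpClosure.lean`) -/

/-- The finitely many strings shorter than `n₀` on which `f` is true. [folklore] -/
def trueBelow (f : List Bool → Bool) (n₀ : ℕ) : List (List Bool) :=
  (List.range n₀).flatMap fun k =>
    ((Finset.univ : Finset (List.Vector Bool k)).toList.map fun v => v.toList).filter fun y => f y

/-- Membership in `trueBelow`. [folklore] -/
theorem mem_trueBelow_iff (f : List Bool → Bool) (n₀ : ℕ) (y : List Bool) :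
    y ∈ trueBelow f n₀ ↔ y.length < n₀ ∧ f y = true := by
  simp only [trueBelow, List.mem_flatMap, List.mem_range, List.mem_filter, List.mem_map, Finset.mem_toList,
    Finset.mem_univ, true_and]
  constructor
  · rintro ⟨k, hk, ⟨v, rfl⟩, hf⟩
    exact ⟨by simpa using hk, hf⟩
  · rintro ⟨hk, hf⟩
    exact ⟨y.length, hk, ⟨⟨y, rfl⟩, rfl⟩, hf⟩

/-! ### The patched evaluator -/

variable (Ev : List Bool → List Bool) (f : List Bool → Bool) (n₀ : ℕ)

/-- **The patched evaluator**: `⟨d, y⟩ ↦ [f y]` for `|y| < n₀` (hard-wired table), `Ev ⟨d, y⟩`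
otherwise. [cite: ImpagliazzoWigderson2001, Lemma 13 ("for all but finitely many n")] -/
def patchEv : List Bool → List Bool :=
  iteFn (ltLenF ∘ fanoutFn sndF (fun _ => ones n₀)) (memListFn (trueBelow f n₀) ∘ sndF) Ev

/-- Value of `patchEv` on a pair. [folklore] -/
theorem patchEv_boolPair (d y : List Bool) :
    patchEv Ev f n₀ (boolPair d y) = if y.length < n₀ then [f y] else Ev (boolPair d y) := by
  unfold patchEv
  rw [iteFn_apply (b := decide (y.length < n₀)) (by simp [fanoutFn_apply, ltLenF_boolPair, ones])]
  by_cases h : y.length < n₀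
  · rw [if_pos (by simp [h]), if_pos h, Function.comp_apply, sndF_boolPair, memListFn_apply]
    simp [mem_trueBelow_iff, h]
  · rw [if_neg (by simp [h]), if_neg h]

/-- `patchEv ∈ FP` for `Ev ∈ FP`. [folklore] -/
theorem patchEv_mem_FP (hEv : Ev ∈ FP) : patchEv Ev f n₀ ∈ FP :=
  iteFn_mem_FP (comp_mem_FP ltLenF_mem_FP (fanoutFn_mem_FP sndF_mem_FP (const_mem_FP _)))
    (comp_mem_FP (memListFn_mem_FP _) sndF_mem_FP) hEv

/-- **Below `n₀` every description computes `f`** relative to the patched evaluator. [folklore] -/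
theorem circuitsFor_patchEv_of_lt {n : ℕ} (hn : n < n₀) : circuitsFor (patchEv Ev f n₀) f n = Set.univ := by
  ext d
  simp only [circuitsFor, Set.mem_setOf_eq, Set.mem_univ, iff_true]
  intro y hy
  rw [patchEv_boolPair, if_pos (hy ▸ hn)]

/-- **From `n₀` on the patched evaluator reads descriptions as `Ev` does.** [folklore] -/
theorem circuitsFor_patchEv_of_le {n : ℕ} (hn : n₀ ≤ n) :
    circuitsFor (patchEv Ev f n₀) f n = circuitsFor Ev f n := by
  ext d
  simp only [circuitsFor, Set.mem_setOf_eq]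
  refine forall_congr' fun y => forall_congr' fun hy => ?_
  rw [patchEv_boolPair, if_neg (by omega)]

end Bootstrap

open Bootstrap in
/-- **IW98 Lemma 16 from a strong construction valid for all sufficiently large lengths.** If `f` is
downward self-reducible (as in `mem_BPP_of_dsr_of_stronglyConstructible`) and some polynomial-time
oracle algorithm `C` with round budget `b` and coin polynomial `p` constructs, for every `n ≥ n₀`,
every `a ≥ 1` and every oracle agreeing with `f` on `{0,1}^n`, a member of `C^f_n` (relative to the
polynomial-time evaluator `Ev`) with probability `≥ 1 − 1/a`, then `f ∈ BPP`: the clocked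
construction `C.clock b ε` (which always answers) is, relative to the patched evaluator `patchEv Ev f n₀`
(hard-wiring `f` below `n₀`), a strong construction of `C^f` at EVERY length, and Lemma 16 applies.
[cite: ImpagliazzoWigderson2001, Lemma 16 with Lemma 13 ("for all but finitely many n")]
[cite: AroraBarakCC2009, §1.4.1 (clocked simulation)] -/
theorem _root_.Literature.Computability.Complexity.IWUniform.mem_BPP_of_dsr_of_eventually_stronglyConstructible
    {f : List Bool → Bool} {Ev : List Bool → List Bool} (hEv : Ev ∈ FP)
    (hSC : ∃ (C : OracleAlg (List Bool)) (b p : Polynomial ℕ) (n₀ : ℕ), C.IsPolyTime (encodingList Bool) ∧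
      ∀ n : ℕ, n₀ ≤ n → ∀ a : ℕ, 1 ≤ a → ∀ O : Oracle, AgreesOn O f n →
        1 - 1 / (a : ℝ) ≤ uniformProb (p.eval (n + a))
          {r | ∃ z ∈ circuitsFor Ev f n, C.run O (b.eval (strongInput n a r).length) (strongInput n a r) = some z})
    {M : OracleAlg (List Bool)} (hM : M.IsPolyTime (encodingList Bool)) {bM : Polynomial ℕ}
    (hDSR : ∀ (x : List Bool) (O : Oracle), (∀ y : List Bool, y.length < x.length → O y = [f y]) →
      M.run O (bM.eval x.length) x = some [f x]) :
    {x | f x = true} ∈ BPP := by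
  obtain ⟨C, b, p, n₀, hC, hgood⟩ := hSC
  refine mem_BPP_of_dsr_of_stronglyConstructible (Ev := patchEv Ev f n₀) (patchEv_mem_FP Ev f n₀ hEv)
    ⟨C.clock b [], b + 1, p, OracleAlg.isPolyTime_clock (encodingList Bool) hC b [], fun n a ha O hO => ?_⟩ hM hDSR
  have hb : ∀ r : List Bool, (b + 1).eval (strongInput n a r).length = b.eval (strongInput n a r).length + 1 := by
    intro r; simp
  by_cases hn : n < n₀
  · -- below `n₀`: the clocked construction always answers, and every answer is good
    rw [circuitsFor_patchEv_of_lt Ev f n₀ hn]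
    have hall : ∀ r : List Bool, r ∈ {r : List Bool | ∃ z ∈ (Set.univ : Set (List Bool)),
        (C.clock b []).run O ((b + 1).eval (strongInput n a r).length) (strongInput n a r) = some z} := by
      intro r
      obtain ⟨z, hz⟩ := Option.isSome_iff_exists.1
        (OracleAlg.run_clock_isSome C b [] O (strongInput n a r) (n := (b + 1).eval (strongInput n a r).length)
          (by rw [hb]; exact Nat.lt_succ_self _))
      exact ⟨z, Set.mem_univ _, hz⟩
    have h1 : uniformProb (p.eval (n + a)) {r : List Bool | ∃ z ∈ (Set.univ : Set (List Bool)),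
        (C.clock b []).run O ((b + 1).eval (strongInput n a r).length) (strongInput n a r) = some z} = 1 := by
      rw [uniformProb_eq_cnt_div, cnt_eq_two_pow_of_forall (fun r _ => hall r)]
      simp
    rw [h1]
    have : (0 : ℝ) ≤ 1 / (a : ℝ) := by positivity
    linarith
  · -- from `n₀` on: the clocked construction answers as `C` whenever `C` answers in time
    push Not at hn
    rw [circuitsFor_patchEv_of_le Ev f n₀ hn]
    refine (hgood n hn a ha O hO).trans (uniformProb_mono_of_imp ?_)
    rintro r ⟨z, hz, hrun⟩
    exact ⟨z, hz, OracleAlg.run_clock_of_run C b [] O _ hrun (by rw [hb]; exact Nat.le_succ _)⟩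

end IWUniform

end Literature.Computability.Complexity

end
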